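import Literature.NumberTheory.EllipticCurves.RingClassFieldGenusProofs
import Literature.NumberTheory.EllipticCurves.RingClassGenusCharacter
import HarnessLib

/-!
# The genus character of conductor `p`, PROVED: `√p* ∈ K[p]` and some `σ ∈ Gal(K[p]/K[1])` has
# `σ(√p*) = −√p*` — discharge of the named fact `sqrt_pStar_mem_ringClassField`

Topic `NumberTheory/EllipticCurves` (class field theory of the ring class fields
`K[n] = ringClassField K ι n ⊂ ℂ` of `HeegnerPointsOfConductor.lean`). Theorems only (no definition,
no named fact; net Literature debt `−1`).

The named fact `Literature.NumberTheory.EllipticCurves.sqrt_pStar_mem_ringClassField`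
(`RingClassGenusCharacter.lean`, typing layer `bsd-littype-06`; consumers: door K1 of route
`SchneiderFreeAdditiveX3`, `Summits/…/Theorems/SchneiderFreeAdditiveX3BranchIMCRebaseHeight.lean`,
and `TwistedHeegnerModule.lean`) records, for `K` imaginary quadratic, `ι : K → ℂ`, `p` an odd prime
with `p ∤ d_K` and `p* = (−1)^{(p−1)/2} p`:
(1) there is `θ ∈ K[p]` with `θ² = p*`; (2) some `σ ∈ Gal(K[p]/K[1])` (tree `ringClassGalOver ι p 1`)
has `σ θ = −θ`. Its docstring says *"Not provable in the tree (class field theory)"*; it IS provable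
from what the tree has proved since (`RingClassFieldGenusProofs.lean`, genus theory of orders on top of
the tree's proved class field theory of `K[f]`):

* (1) is `Cox2013_sqrt_pStar_mem_ringClassField_holds` (every complex square root of `p*` lies in
  `K[p]`; Cox 2013 Thm. 9.18 with Cor. 8.7 / §9.A / Thm. 6.1 / Thm. 11.1), i.e.
  `sqrt_intCast_mem_ringClassField` with `d = p* ≡ 1 (mod 4)`, `f = p`;
* (2): `√p* ∉ K[1]` is `sqrt_intCast_not_mem_ringClassField` with `m = 1`, `ℓ = p` (`p ∥ p*`,
  `p ∤ 1`, `p ∤ d_K`: `K[1]/K` is unramified above `p` while `K(√p*)/K` ramifies there — Cox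
  Thm. 8.10 / §9.A p. 180, Neukirch III (2.12)); `K[p]/K` is finite Galois
  (`finiteDimensional_and_isGalois_ringClassField`, Cox §9.A), hence Galois over the intermediate
  field `M = {x ∈ K[p] : x ∈ K[1]}` (`K ⊆ M` as `ι(K) ⊆ K[1]`), and by the Galois correspondence
  (Mathlib `IsGalois.fixedField_fixingSubgroup`) an element of `K[p]` outside `M` is moved by some
  `σ ∈ Gal(K[p]/M)`; such a `σ` moves `θ` to `±θ` (`algEquiv_apply_eq_or_eq_neg_of_sq_eq`,
  Silverman X.2 proof of Prop. 2.4), hence to `−θ`, and — restricted to `ℚ`-scalars — lies in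
  `ringClassGalOver ι p 1` (the subgroup of `Aut_ℚ(K[p])` fixing pointwise the elements of `K[p]`
  that lie in `K[1]`).

HONEST FRAMING: classical, published class field theory (the genus character of conductor `p` is a
primitive ring class character); no statement about elliptic curves, `L`-functions or BSD is made.
For the consumers this turns one carried HYPOTHESIS (`(h : sqrt_pStar_mem_ringClassField)`, fed e.g.
through `exists_genusDatum_of`) into a theorem (`sqrt_pStar_mem_ringClassField_holds`); nothing else
changes. Found by the ARM-P cited-input audit (cell `pub/bsd-cited`, seat r10, base-role discharge).

## References

* D. A. Cox, *Primes of the form x² + ny²*, 2nd ed. (2013): §6.A Thm. 6.1, Thm. 8.10, proof of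
  Thm. 8.12 (p. 180), §9.A (p. 180; Thm. 9.2, Lemma 9.3), Thm. 9.18, §11.A Thm. 11.1. [Cox2013]
* C. Cornut, V. Vatsal, *Nontriviality of Rankin–Selberg `L`-functions and CM points*, LMS LN 320
  (2007), §1.1 ¶"Ring class characters". [CornutVatsal2007]
* J. H. Silverman, *The Arithmetic of Elliptic Curves*, 2nd ed. (2009), X.2 Prop. 2.4 (proof).
  [SilvermanAEC2009]
* J. Neukirch, *Algebraic Number Theory* (1999), Ch. III Thm. (2.12). [NeukirchANT1999]

## Mathlib / tree search

Tree, by name: `Cox2013_sqrt_pStar_mem_ringClassField_holds`, `sqrt_intCast_not_mem_ringClassField`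
(`RingClassFieldGenusProofs`), `finiteDimensional_and_isGalois_ringClassField`,
`apply_mem_ringClassField`, `coe_algebraMap_ringClassField`, `ringClassGalOver`
(`HeegnerPointsOfConductor`), `algEquiv_apply_eq_or_eq_neg_of_sq_eq` (`RingClassGenusCharacter`);
Mathlib: `IsGalois.fixedField_fixingSubgroup`, `IntermediateField.mem_fixingSubgroup_iff`,
`Subfield.toIntermediateField`, `AlgEquiv.restrictScalars`.
`rg 'sqrt_pStar_mem_ringClassField_holds'` over `lean/`: no prior discharge.
-/

noncomputable section

open scoped Classical

namespace Literature.NumberTheory.EllipticCurves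

/-- `p² ∤ p* = (−1)^{(p−1)/2} p` for a prime `p` (`|p*| = p < p²`). [folklore] -/
private theorem not_sq_dvd_pStar {p : ℕ} (hp : p.Prime) :
    ¬ (p : ℤ) ^ 2 ∣ (-1) ^ (p / 2) * (p : ℤ) := by
  intro h
  have hdabs : ((-1 : ℤ) ^ (p / 2) * (p : ℤ)).natAbs = p := by
    rw [Int.natAbs_mul, Int.natAbs_pow, Int.natAbs_neg, Int.natAbs_one, one_pow, one_mul,
      Int.natAbs_natCast]
  have h' : p ^ 2 ∣ p := by
    have := Int.natAbs_dvd_natAbs.mpr h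
    rwa [Int.natAbs_pow, Int.natAbs_natCast, hdabs] at this
  have hle : p ^ 2 ≤ p := Nat.le_of_dvd hp.pos h'
  nlinarith [hp.two_le]

/-- **The named fact `sqrt_pStar_mem_ringClassField` HOLDS** (Cox 2013 Thm. 9.18 / §9.A / Thm. 8.10;
Cornut–Vatsal 2007 §1.1: the genus character `σ ↦ σ(√p*)/√p*` of `Gal(K[p]/K)` is a primitive ring
class character of conductor `p`): for `K` imaginary quadratic, `ι : K → ℂ`, `p` an odd prime with
`p ∤ d_K`, there is `θ ∈ K[p]` with `θ² = p*` (`Cox2013_sqrt_pStar_mem_ringClassField_holds`), and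
some `σ ∈ Gal(K[p]/K[1]) = ringClassGalOver ι p 1` has `σ θ = −θ` (as `√p* ∉ K[1]`,
`sqrt_intCast_not_mem_ringClassField`, and `K[p]/K` is Galois). Discharges the genus-theory
hypothesis of door K1 of route `SchneiderFreeAdditiveX3` (fed through `exists_genusDatum_of`).
[cite: Cox2013, Thm. 9.18 (with Cor. 8.7, §9.A p. 180, Thm. 6.1, Thm. 8.10, Thm. 11.1)]
[cite: CornutVatsal2007, §1.1 ¶"Ring class characters"] -/
theorem sqrt_pStar_mem_ringClassField_holds : sqrt_pStar_mem_ringClassField := by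
  intro K _ _ hK ι p hp hp2 hpd
  -- (1) a complex square root `θ₀` of `p*`; it lies in `K[p]`
  obtain ⟨θ₀, hθ₀⟩ := IsAlgClosed.exists_pow_nat_eq ((-1 : ℂ) ^ (p / 2) * (p : ℂ)) two_pos
  have hmem : θ₀ ∈ ringClassField K ι p :=
    Cox2013_sqrt_pStar_mem_ringClassField_holds K hK ι p hp hp2 hpd θ₀ hθ₀
  set L := ringClassField K ι p with hL
  set θ : L := ⟨θ₀, hmem⟩ with hθ_def
  have hq : (algebraMap ℚ L ((-1 : ℚ) ^ (p / 2) * p) : ℂ) = (-1 : ℂ) ^ (p / 2) * (p : ℂ) := by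
    rw [eq_ratCast, SubfieldClass.coe_ratCast]
    push_cast
    rfl
  have hθsq : θ ^ 2 = algebraMap ℚ L ((-1 : ℚ) ^ (p / 2) * p) := by
    apply Subtype.ext
    rw [SubmonoidClass.coe_pow, hq]
    exact hθ₀
  -- (2a) `θ₀ ∉ K[1]`: `p ∥ p*`, `p ∤ 1`, `p ∤ d_K`
  have hnot : θ₀ ∉ ringClassField K ι 1 := by
    have hθ₀' : θ₀ ^ 2 = (((-1) ^ (p / 2) * (p : ℤ) : ℤ) : ℂ) := by
      rw [hθ₀]; push_cast; ring
    exact sqrt_intCast_not_mem_ringClassField hK ι one_ne_zero hp (Dvd.intro_left _ rfl)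
      (not_sq_dvd_pStar hp) hp.not_dvd_one hpd θ₀ hθ₀'
  -- (2b) Galois theory of `K[p]/K` over the intermediate field `M = {x ∈ K[p] : x ∈ K[1]}`
  haveI := (finiteDimensional_and_isGalois_ringClassField hK ι hp.ne_zero).1
  haveI := (finiteDimensional_and_isGalois_ringClassField hK ι hp.ne_zero).2
  let S : Subfield L := Subfield.comap L.subtype (ringClassField K ι 1)
  have hSmem : ∀ x : L, x ∈ S ↔ (x : ℂ) ∈ ringClassField K ι 1 := fun x ↦ Iff.rfl
  let M : IntermediateField K L := S.toIntermediateField fun k ↦ (hSmem _).mpr (by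
    rw [coe_algebraMap_ringClassField]
    exact apply_mem_ringClassField ι 1 k)
  have hMmem : ∀ x : L, x ∈ M ↔ (x : ℂ) ∈ ringClassField K ι 1 := fun x ↦ Iff.rfl
  have hθM : ¬ ∀ σ ∈ M.fixingSubgroup, σ θ = θ := by
    rw [← IntermediateField.mem_fixedField_iff, IsGalois.fixedField_fixingSubgroup M]
    exact fun h ↦ hnot ((hMmem θ).mp h)
  push Not at hθM
  obtain ⟨σ, hσM, hσθ⟩ := hθM
  -- `σ θ = −θ`, and `σ` (over `ℚ`) lies in `Gal(K[p]/K[1])`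
  let τ : L ≃ₐ[ℚ] L := σ.restrictScalars ℚ
  have hτθ : τ θ = -θ := by
    rcases algEquiv_apply_eq_or_eq_neg_of_sq_eq hθsq τ with h | h
    · exact absurd h hσθ
    · exact h
  refine ⟨θ, hθsq, τ, ?_, hτθ⟩
  rw [ringClassGalOver, mem_fixingSubgroup_iff]
  intro y hy
  rw [AlgEquiv.smul_def, AlgEquiv.restrictScalars_apply]
  exact (IntermediateField.mem_fixingSubgroup_iff M σ).mp hσM y ((hMmem y).mpr hy)

end Literature.NumberTheory.EllipticCurves

end
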